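import Summits.BirchSwinnertonDyer.BirchSwinnertonDyer.Theses.LeadingTerm
import Summits.BirchSwinnertonDyer.BirchSwinnertonDyer.Theorems.PAdicOrderPadicBSDrankR2.Negative.ConsequencesOfCrux
import Summits.BirchSwinnertonDyer.BirchSwinnertonDyer.Theorems.PAdicOrderThesisR2.Negative.AtEveryGoodPrimeFalse
import Literature.NumberTheory.EllipticCurves.CanonicalPAdicHeightHolds

/-!
# `LeadingTerm.PinchPrime` (crux stmt-BirchSwinnertonDyer-16218, route `LeadingTerm`):
# what any proof must deliver — rank-zero BSD in both directions and Mordell–Weil parity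
# (negative-side support, refuter crux-attack seat; this file does NOT refute the crux)

Write `S` for the crux: every elliptic `E/ℚ` (globally minimal `W`) has a good ordinary prime
`p ≥ 5`, a canonical cyclotomic height datum `D` at `p`, and a newform `f` (`IsNewformOf W f`) with
`ord_{T=0} L_p(f, unitRoot W p, T) = rank_ℤ W(ℚ)` — the `∃ p`-form of the Mazur–Tate–Teitelbaum
rank clause BSD(p)(i) (the `∀ p` form is the sibling crux `PAdicOrderV2.PAdicOrderPadicBSDrankR2`,
stmt-0490, whose `Negative/ConsequencesOfCrux` this file parallels). Reading `S` through the two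
closed-form windows on `ord_T L_p` that are THEOREMS of the tree — the level-zero window
`ord_T L_p = 0 ↔ r_an = 0` (Mazur–Tate–Teitelbaum interpolation + Hasse;
`Cruxes.PAdicOrderThesisR2.KatoSandwich.order_padicLFunction_eq_zero_iff_analyticRank_eq_zero`) and
the parity window `ord_T L_p ≡ r_an (mod 2)` at an odd good ordinary prime of conductor level
(`Literature.Barriers.BirchSwinnertonDyer.even_order_padicLFunction_iff_even_analyticRank_conductorLevel`,
Greenberg LNM 1716 §5) — gives, sorry-free:

* `modularity_of_pinchPrime` — `S ⇒` every globally minimal elliptic `W/ℚ` is modular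
  (`∃ f, IsNewformOf W f`; a theorem in print, BCDT 2001, a named fact in the tree): the crux
  carries modularity.
* `rank_eq_zero_iff_analyticRank_eq_zero_of_pinchPrime` — `S ⇒ (rank_ℤ W(ℚ) = 0 ↔ r_an(W) = 0)`
  for EVERY globally minimal elliptic `W` (no modularity hypothesis: `S` supplies the newform). The
  direction `rank = 0 ⇒ L(E,1) ≠ 0` is the open rank-zero converse to Kolyvagin–Kato: `S` is at
  least that hard.
* `pinch_iff_analyticRank_eq_zero_of_rank_eq_zero`, `pinchPrime_at_rank_zero_iff` — conversely, at
  a curve of Mordell–Weil rank `0` the pointwise content of `S` at ANY good ordinary `(p, f)` is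
  EXACTLY `r_an(W) = 0`; so on rank-`0` curves `S` restates the lower-bound half of BSD-rank and
  the `∃ p` gains nothing there (in rank `≥ 1` it is transverse to BSD: it carries
  `#Ш(E)[p^∞] < ∞` and Schneider non-degeneracy at the pinch prime).
* `mordellWeilParity_of_pinchPrime` — `S ∧` Carayol's level `=` conductor
  (`IsNewformOf.level_eq_conductorNorm`, a named fact) `⇒` the Mordell–Weil parity conjecture
  `rank_ℤ E(ℚ) ≡ ord_{s=1} L(E,s) (mod 2)` for every globally minimal elliptic `W/ℚ` (open in
  print; known for `p^∞`-Selmer coranks, Dokchitser–Dokchitser 2010).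
* `order_ne_rank_at_seven_congruentNumberCurve_one` — junk-model check: at a good SUPERSINGULAR
  prime the tree's order is `⊤`, never the rank (`unitRoot = 0`, `L_p(f, 0, T) = 0`, sibling seat's
  `order_ne_natCast_of_dvd`); the pinch prime of any witness is therefore genuinely ordinary, and
  weakening `IsOrdinaryAt` to good reduction in an `∃ p` statement refutes nothing.

The `∃ D, D.IsCanonical` conjunct of `S` is decoration (`D` occurs nowhere else; a canonical datum
exists at every good ordinary `p ≥ 5`, `WeierstrassCurve.exists_isCanonical_holds`) and is simply
discarded below.
-/

noncomputable section

-- D-0017: single-problem summit, so `Summit.BirchSwinnertonDyer.BirchSwinnertonDyer.…` repeats a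
-- namespace BY DESIGN.
set_option linter.dupNamespace false

namespace Summit.BirchSwinnertonDyer.BirchSwinnertonDyer.Theorems.PinchPrime.Negative

open scoped MatrixGroups ModularForm
open CongruenceSubgroup Literature.NumberTheory.EllipticCurves
  Literature.NumberTheory.EllipticCurves.ModularForms
open Summit.BirchSwinnertonDyer.BirchSwinnertonDyer.Theses
open Summit.BirchSwinnertonDyer.BirchSwinnertonDyer.Theorems.PAdicOrderThesisR2.Negative

section Consequences

variable (hS : LeadingTerm.PinchPrime)
include hS

/-- **`S` carries modularity** of every globally minimal elliptic `W/ℚ` (the `∃ f, IsNewformOf W f`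
conjunct; Breuil–Conrad–Diamond–Taylor 2001, Thm A). [folklore] -/
theorem modularity_of_pinchPrime (W : WeierstrassCurve ℚ) [W.IsElliptic] [W.IsGloballyMinimal] :
    ∃ (N : ℕ) (_ : NeZero N) (f : CuspForm (Gamma0 N) 2), IsNewformOf W f := by
  obtain ⟨_p, _hp, _h5, _hord, _D, _hD, N, hN, f, hf, _⟩ := hS W
  exact ⟨N, hN, f, hf⟩

/-- **The pinch prime is odd** (it is `≥ 5`), with the height datum discarded. [folklore] -/
theorem exists_odd_pinch (W : WeierstrassCurve ℚ) [W.IsElliptic] [W.IsGloballyMinimal] :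
    ∃ (p : ℕ) (_ : Fact p.Prime), p ≠ 2 ∧ IsOrdinaryAt W p ∧
      ∃ (N : ℕ) (_ : NeZero N) (f : CuspForm (Gamma0 N) 2),
        IsNewformOf W f ∧ (padicLFunction f (unitRoot W p : ℚ_[p])).order = W.mordellWeilRank := by
  obtain ⟨p, hp, h5, hord, _D, _hD, N, hN, f, hf, horder⟩ := hS W
  exact ⟨p, hp, by omega, hord, N, hN, f, hf, horder⟩

/-- **`S` decides rank zero against analytic rank zero for every curve**: from the proved
level-zero window `ord_T L_p = 0 ↔ r_an = 0` (Mazur–Tate–Teitelbaum 1986, §I.14 (14.3): `L_p(E,0) =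
(1 - α⁻¹)² L(E,1)/Ω⁺`, `α ≠ 1` by Hasse) at the pinch prime, `rank_ℤ W(ℚ) = 0 ↔ r_an(W) = 0`.
[cite: MazurTateTeitelbaum1986Invent, §I.14 (14.3) and §II.10] -/
theorem rank_eq_zero_iff_analyticRank_eq_zero_of_pinchPrime (W : WeierstrassCurve ℚ)
    [W.IsElliptic] [W.IsGloballyMinimal] : W.mordellWeilRank = 0 ↔ W.analyticRank = 0 := by
  obtain ⟨p, hp, _h5, hord, _D, _hD, N, hN, f, hf, horder⟩ := hS W
  rw [← Cruxes.PAdicOrderThesisR2.KatoSandwich.order_padicLFunction_eq_zero_iff_analyticRank_eq_zero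
    W p hord hf, horder]
  exact_mod_cast Iff.rfl

/-- In particular `S` forbids a curve of Mordell–Weil rank `0` with `L(E,1) = 0`: the open
rank-zero converse to Kolyvagin–Kato. [folklore] -/
theorem analyticRank_eq_zero_of_rank_eq_zero_of_pinchPrime (W : WeierstrassCurve ℚ)
    [W.IsElliptic] [W.IsGloballyMinimal] (h0 : W.mordellWeilRank = 0) : W.analyticRank = 0 :=
  (rank_eq_zero_iff_analyticRank_eq_zero_of_pinchPrime hS W).mp h0

/-- **`S ∧` Carayol `⇒` the Mordell–Weil parity conjecture.** Granting the named fact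
`IsNewformOf.level_eq_conductorNorm` (the level of the newform of `W` is `N_W`; Carayol 1986,
Diamond–Shurman Thm 8.8.1) at every level, `rank_ℤ W(ℚ) ≡ r_an(W) (mod 2)` for every globally
minimal elliptic `W/ℚ`, through the proved `p`-adic parity `ord_T L_p ≡ r_an (mod 2)` at the (odd)
pinch prime (Greenberg, LNM 1716, §5). [cite: DiamondShurman2005, Thm. 8.8.1] -/
theorem mordellWeilParity_of_pinchPrime
    (hlev : ∀ {N : ℕ} [NeZero N], IsNewformOf.level_eq_conductorNorm (N := N))
    (W : WeierstrassCurve ℚ) [W.IsElliptic] [W.IsGloballyMinimal] :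
    Even W.mordellWeilRank ↔ Even W.analyticRank := by
  obtain ⟨p, hp, hp2, hord, N, hN, f, hf, horder⟩ := exists_odd_pinch hS W
  obtain rfl : N = W.conductorNorm ℤ := hlev hf
  rw [← Literature.Barriers.BirchSwinnertonDyer.even_order_padicLFunction_iff_even_analyticRank_conductorLevel
    hp2 hord hf, horder]
  simp

end Consequences

/-! ## Rank zero: the crux restates the lower-bound half of BSD-rank -/

/-- **Rank zero, pointwise.** At a curve of Mordell–Weil rank `0`, for ANY good ordinary `p` and
the newform `f`, `ord_T L_p(f, α_p, T) = rank ↔ r_an(W) = 0` (the proved level-zero window).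
[cite: MazurTateTeitelbaum1986Invent, §I.14 (14.3) and §II.10] -/
theorem pinch_iff_analyticRank_eq_zero_of_rank_eq_zero (W : WeierstrassCurve ℚ) [W.IsElliptic]
    [W.IsGloballyMinimal] (h0 : W.mordellWeilRank = 0) (p : ℕ) [Fact p.Prime]
    (hord : IsOrdinaryAt W p) {N : ℕ} [NeZero N] {f : CuspForm (Gamma0 N) 2}
    (hf : IsNewformOf W f) :
    (padicLFunction f (unitRoot W p : ℚ_[p])).order = W.mordellWeilRank ↔ W.analyticRank = 0 := by
  rw [h0, Nat.cast_zero]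
  exact Cruxes.PAdicOrderThesisR2.KatoSandwich.order_padicLFunction_eq_zero_iff_analyticRank_eq_zero
    W p hord hf

/-- **Rank zero, the whole instance.** Granting modularity (`exists_isNewformOf`, to produce the
newform in the converse direction), the `W`-instance of the crux at a curve of Mordell–Weil rank
`0` is EQUIVALENT to `r_an(W) = 0`: a good ordinary `p ≥ 5` (`exists_good_ordinary_prime_holds`)
and a canonical datum (`exists_isCanonical_holds`) always exist, so `∃ p` gains nothing in rank `0`.
[folklore] -/
theorem pinchPrime_at_rank_zero_iff (hmod : exists_isNewformOf) (W : WeierstrassCurve ℚ)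
    [W.IsElliptic] [W.IsGloballyMinimal] (h0 : W.mordellWeilRank = 0) :
    (∃ (p : ℕ) (_ : Fact p.Prime), 5 ≤ p ∧ IsOrdinaryAt W p ∧
      ∃ (D : WeierstrassCurve.PAdicHeightData W p), D.IsCanonical ∧
        ∃ (N : ℕ) (_ : NeZero N) (f : CuspForm (Gamma0 N) 2), IsNewformOf W f ∧
          (padicLFunction f (unitRoot W p : ℚ_[p])).order = W.mordellWeilRank) ↔
      W.analyticRank = 0 := by
  constructor
  · rintro ⟨p, hp, _h5, hord, _D, _hD, N, hN, f, hf, horder⟩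
    exact (pinch_iff_analyticRank_eq_zero_of_rank_eq_zero W h0 p hord hf).mp horder
  · intro han
    haveI : NeZero (W.conductorNorm ℤ) := ⟨(WeierstrassCurve.conductorNorm_pos_holds (W := W)).ne'⟩
    obtain ⟨f, hf⟩ := hmod W
    obtain ⟨p, hp, h5, hgood, hord⟩ := WeierstrassCurve.exists_good_ordinary_prime_holds W
    obtain ⟨D, hD⟩ := WeierstrassCurve.exists_isCanonical_holds W p h5 hgood hord
    exact ⟨p, hp, h5, ⟨hgood, hord⟩, D, hD, _, inferInstance, f, hf,
      (pinch_iff_analyticRank_eq_zero_of_rank_eq_zero W h0 p ⟨hgood, hord⟩ hf).mpr han⟩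

/-! ## Junk-model check: the pinch prime is automatically ordinary -/

/-- At the good supersingular prime `p = 7` of `E₁ : y² = x³ - x` (`a_7 = 0`) the tree's order of
vanishing is `⊤`, never the Mordell–Weil rank, for every candidate newform `f`: the typed `ord = rank`
is unobtainable off the ordinary locus, so an `∃ p` witness is automatically ordinary
(Mazur–Tate–Teitelbaum 1986, §I.11: the construction needs an allowable root).
[cite: MazurTateTeitelbaum1986Invent, §I.11 (allowable root)] -/
theorem order_ne_rank_at_seven_congruentNumberCurve_one [Fact (Nat.Prime 7)]
    [(congruentNumberCurve 1).IsGloballyMinimal] {N : ℕ} (f : CuspForm (Gamma0 N) 2) :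
    (padicLFunction f (unitRoot (congruentNumberCurve 1) 7 : ℚ_[7])).order ≠
      (congruentNumberCurve 1).mordellWeilRank :=
  order_ne_natCast_of_dvd _ 7 seven_dvd_frobeniusTrace_congruentNumberCurve_one f _

end Summit.BirchSwinnertonDyer.BirchSwinnertonDyer.Theorems.PinchPrime.Negative

end
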